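import Literature.NumberTheory.NumberFields.CyclicCubicField103Primes
import Literature.NumberTheory.NumberFields.CyclicCubicField13Primes
import Literature.NumberTheory.EllipticCurves.TwoDescentParity
import HarnessLib

/-!
# The cyclic cubic field of conductor `103`: the norm-`1` `2`-descent of `480a1` over `K`

Let `K = ℚ(θ)`, `θ³ + θ² - 34θ - 61 = 0`, be the cyclic cubic field of conductor `103`
(`CyclicCubicField103.lean`, `CyclicCubicField103Primes.lean`: integral basis `1, θ, ω`, units
`u₁, u₂` and units modulo squares via real signs, `2, 5` inert, `3 = 𝔮₁𝔮₂𝔮₃` split with residue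
fields `𝔽₃`, class number one, the reduction map `ψ₈ : 𝓞 K → 𝓞 K/8 = CubicRing (ℤ/8) 61 34 (-1)`).
The main result is

* `normDescent`: if `(x, y) ∈ K²` satisfies `y² = x(x+2)(x-3)` with `y ≠ 0` and both `N_{K/ℚ}(x)`,
  `N_{K/ℚ}(x+2)` are squares in `ℚ`, then `x` and `x + 2` are squares in `K`;
* `normDescent_of_root`: the same over ANY cubic extension `K'/ℚ` containing a root of
  `f = X³ + X² - 34X - 61` (transport along `K ≃ₐ[ℚ] K'`).

This is the norm-`1` part of the complete `2`-descent [SilvermanAEC2009, Ch. X §1, Prop. X.1.4] of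
`480a1` over `K`, the second of the four cubic descents behind
`Literature.Barriers.BirchSwinnertonDyer.DokchitserDokchitser2011_rank_480a1_F3`
[DokchitserDokchitser2011RankModN, proof of Thm. 2]. The argument (cf. `CyclicCubicField13Descent.lean`,
which this file follows; the present field is simpler in that no prime above `5` splits):

1. *`x + 2 = B²`.* All valuations of `x + 2` are even (at the inert `(2)`, `(5)` by the norm
   condition — a `σ`-invariant valuation takes equal values on conjugates — and elsewhere by the
   curve equation, `Literature.NumberTheory.EllipticCurves.TwoDescentParity`), so with `h_K = 1`
   `x + 2 = u' B²` for a unit `u'`; `N(x + 2) = □` gives `N(u') = 1` and total positivity of `x + 2`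
   (real places) gives `u' = 1` (`units modulo squares ≅ {±1}³` by signs).
2. *`x = u A²`, `u ∈ {1, u₁, u₂, u₁u₂}`.* At a prime `𝔮 ∣ 3` the residue field is `𝔽₃`, in which
   `-1` is not a square, so `x = B² - 2 ≡ B² + 1` has even (indeed zero or negative even) order;
   the other valuations of `x` are even as in step 1; `N(x) = □` forces the norm-`1` classes.
3. *The prime `2`.* Reducing `x = αA²`, `x + 2 = B²`, `x - 3 = αC²` modulo `8` (clearing odd integral
   denominators, cases `ord₂ A <, =, > 0`) the kernel-checked tables `no_solution_n0/n1/n2` exclude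
   `α ∈ {u₁, u₂, u₁u₂}`; hence `x = A²`.

No named facts are introduced.
-/

noncomputable section

open Polynomial NumberField Algebra Ideal IsDedekindDomain IsDedekindDomain.HeightOneSpectrum
open scoped WithZero

namespace Literature.NumberTheory.NumberFields

/-! ### Coefficientwise functoriality of `CubicRing` -/

/-- **Coefficientwise application of a ring homomorphism `g : R → S`** is a ring homomorphism
`CubicRing R p q r → CubicRing S (g p) (g q) (g r)`. [folklore] -/
def CubicRing.mapHom {R S : Type*} [CommRing R] [CommRing S] {p q r : R} (g : R →+* S) :
    CubicRing R p q r →+* CubicRing S (g p) (g q) (g r) where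
  toFun a := ⟨g a.c0, g a.c1, g a.c2⟩
  map_zero' := by ext <;> simp
  map_one' := by ext <;> simp
  map_add' a b := by ext <;> simp
  map_mul' a b := by ext <;> simp [CubicRing.mul_c0, CubicRing.mul_c1, CubicRing.mul_c2]

/-- Unfolding `CubicRing.mapHom`. [folklore] -/
@[simp] theorem CubicRing.mapHom_apply {R S : Type*} [CommRing R] [CommRing S] {p q r : R}
    (g : R →+* S) (a : CubicRing R p q r) : CubicRing.mapHom g a = ⟨g a.c0, g a.c1, g a.c2⟩ := rfl

namespace CyclicCubic103

/-! ### The finite checks modulo `8` in `𝓞 K/8 = CubicRing (ℤ/8) 61 34 (-1)` -/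

namespace O8

/-- The reduction `ℤ/8 → ℤ/2`. [folklore] -/
def c82 : ZMod 8 →+* ZMod 2 := ZMod.castHom (by norm_num : 2 ∣ 8) (ZMod 2)

/-- `𝓞 K/2 = 𝔽₈` as a `CubicRing` over `ℤ/2`. [folklore] -/
abbrev O2 : Type := CubicRing (ZMod 2) (c82 61) (c82 34) (c82 (-1))

/-- The reduction `𝓞 K/8 → 𝓞 K/2`. [folklore] -/
def red82 : O8 →+* O2 := CubicRing.mapHom c82

/-- **"Odd" elements of `𝓞/8`**: some coefficient is odd (non-zero image in `𝔽₈`). [folklore] -/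
def IsOdd (u : O8) : Prop := u.c0.val % 2 = 1 ∨ u.c1.val % 2 = 1 ∨ u.c2.val % 2 = 1

/-- Oddness is decidable. [folklore] -/
instance : DecidablePred IsOdd := fun u => by unfold IsOdd; infer_instance

set_option maxRecDepth 20000 in
set_option maxHeartbeats 4000000 in
/-- Oddness is non-vanishing in `𝔽₈` (by computation). [folklore] -/
theorem isOdd_iff_red82_ne_zero : ∀ u : O8, IsOdd u ↔ red82 u ≠ 0 := by decide +kernel

/-- The `28` squares of odd elements of `𝓞/8` (coordinates on `1, t, t²`). [folklore] -/
def usq8 : List O8 := [⟨0, 0, 1⟩, ⟨0, 4, 1⟩, ⟨0, 7, 1⟩, ⟨0, 7, 5⟩, ⟨1, 0, 0⟩, ⟨1, 2, 1⟩, ⟨1, 2, 5⟩,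
  ⟨1, 3, 6⟩, ⟨1, 4, 4⟩, ⟨1, 6, 1⟩, ⟨1, 6, 5⟩, ⟨1, 7, 6⟩, ⟨2, 1, 4⟩, ⟨2, 5, 0⟩, ⟨3, 3, 3⟩, ⟨3, 3, 7⟩,
  ⟨4, 0, 1⟩, ⟨4, 3, 1⟩, ⟨4, 3, 5⟩, ⟨4, 4, 1⟩, ⟨5, 0, 4⟩, ⟨5, 3, 2⟩, ⟨5, 4, 0⟩, ⟨5, 7, 2⟩, ⟨6, 1, 4⟩,
  ⟨6, 5, 0⟩, ⟨7, 3, 3⟩, ⟨7, 3, 7⟩]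

/-- The `36` squares of `𝓞/8`. [folklore] -/
def asq8 : List O8 := [⟨0, 0, 0⟩, ⟨0, 0, 1⟩, ⟨0, 0, 4⟩, ⟨0, 4, 0⟩, ⟨0, 4, 1⟩, ⟨0, 4, 4⟩, ⟨0, 7, 1⟩,
  ⟨0, 7, 5⟩, ⟨1, 0, 0⟩, ⟨1, 2, 1⟩, ⟨1, 2, 5⟩, ⟨1, 3, 6⟩, ⟨1, 4, 4⟩, ⟨1, 6, 1⟩, ⟨1, 6, 5⟩, ⟨1, 7, 6⟩,
  ⟨2, 1, 4⟩, ⟨2, 5, 0⟩, ⟨3, 3, 3⟩, ⟨3, 3, 7⟩, ⟨4, 0, 0⟩, ⟨4, 0, 1⟩, ⟨4, 0, 4⟩, ⟨4, 3, 1⟩, ⟨4, 3, 5⟩,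
  ⟨4, 4, 0⟩, ⟨4, 4, 1⟩, ⟨4, 4, 4⟩, ⟨5, 0, 4⟩, ⟨5, 3, 2⟩, ⟨5, 4, 0⟩, ⟨5, 7, 2⟩, ⟨6, 1, 4⟩, ⟨6, 5, 0⟩,
  ⟨7, 3, 3⟩, ⟨7, 3, 7⟩]

set_option maxRecDepth 20000 in
set_option maxHeartbeats 4000000 in
/-- Every odd square of `𝓞/8` is in `usq8` (by computation over the `512` elements). [folklore] -/
theorem sq_mem_usq8 : ∀ u : O8, IsOdd u → u * u ∈ usq8 := by decide +kernel

set_option maxRecDepth 20000 in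
set_option maxHeartbeats 4000000 in
/-- Every square of `𝓞/8` is in `asq8` (by computation). [folklore] -/
theorem sq_mem_asq8 : ∀ u : O8, u * u ∈ asq8 := by decide +kernel

/-- The images in `𝓞/8` of the three non-trivial norm-`1` unit classes:
`ψ₈(u₁) = ⟨0, 3, 6⟩`, `ψ₈(u₂) = ⟨0, 2, 1⟩`, `ψ₈(u₁u₂) = ⟨5, 0, 1⟩`. [folklore] -/
def candidates3 : List O8 := [⟨0, 3, 6⟩, ⟨0, 2, 1⟩, ⟨5, 0, 1⟩]

set_option maxRecDepth 20000 in
set_option maxHeartbeats 4000000 in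
/-- **Case `v₂(x) = 0`**: `α s + 2 = s'` and `α s - 3 = α s''` have no solution with `s, s'` odd
squares and `s''` a square in `𝓞/8` (by computation). [folklore] -/
theorem no_solution_n0 : ∀ a ∈ candidates3, ∀ s ∈ usq8, ∀ s' ∈ usq8, a * s + 2 = s' →
    ∀ s'' ∈ asq8, a * s - 3 ≠ a * s'' := by decide +kernel

set_option maxRecDepth 20000 in
set_option maxHeartbeats 4000000 in
/-- **Case `v₂(x) = -2`**: `α s = s'` and `α s + 4 = α s''` have no solution in odd squares (by
computation). [folklore] -/
theorem no_solution_n1 : ∀ a ∈ candidates3, ∀ s ∈ usq8, ∀ s' ∈ usq8, a * s = s' →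
    ∀ s'' ∈ usq8, a * s + 4 ≠ a * s'' := by decide +kernel

set_option maxRecDepth 20000 in
set_option maxHeartbeats 4000000 in
/-- **Case `v₂(x) ≤ -4`**: `α s = s'` and `α s = α s''` have no solution in odd squares (by
computation). [folklore] -/
theorem no_solution_n2 : ∀ a ∈ candidates3, ∀ s ∈ usq8, ∀ s' ∈ usq8, a * s = s' →
    ∀ s'' ∈ usq8, a * s ≠ a * s'' := by decide +kernel

end O8

open O8

/-! ### The inert primes `(2)`, `(5)` as points of the height-one spectrum -/

/-- `(2)` is prime, of residue degree `3`, the only prime above `2`. [folklore] -/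
theorem span_two : (span {(2 : 𝓞 K)}).IsPrime ∧ (span {(2 : 𝓞 K)}).inertiaDeg ℤ = 3 ∧
    ∀ P ∈ primesOver (span {(2 : ℤ)}) (𝓞 K), P = span {(2 : 𝓞 K)} := by
  have h := span_inert (p := 2) (Or.inl rfl); push_cast at h; exact h

/-- `(5)` is prime, of residue degree `3`, the only prime above `5`. [folklore] -/
theorem span_five : (span {(5 : 𝓞 K)}).IsPrime ∧ (span {(5 : 𝓞 K)}).inertiaDeg ℤ = 3 ∧
    ∀ P ∈ primesOver (span {(5 : ℤ)}) (𝓞 K), P = span {(5 : 𝓞 K)} := by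
  have h := span_inert (p := 5) (Or.inr (Or.inl rfl)); push_cast at h; exact h

/-- A prime `P` of `𝓞 K` containing the rational prime `p` lies over `(p) ⊂ ℤ`. [folklore] -/
theorem mem_primesOver_of_mem {p : ℕ} (hp : p.Prime) {P : Ideal (𝓞 K)} [hP : P.IsPrime]
    (hmem : (p : 𝓞 K) ∈ P) : P ∈ primesOver (span {(p : ℤ)}) (𝓞 K) := by
  haveI : Fact p.Prime := ⟨hp⟩
  refine ⟨hP, ⟨?_⟩⟩
  refine (Int.ideal_span_isMaximal_of_prime p).eq_of_le (Ideal.comap_ne_top _ hP.ne_top) ?_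
  rw [Ideal.span_singleton_le_iff_mem, Ideal.mem_comap, map_natCast]
  exact hmem

/-- **The prime `v₂ = (2)`**. [folklore] -/
def v₂ : HeightOneSpectrum (𝓞 K) := ⟨span {(2 : 𝓞 K)}, span_two.1, by
  rw [Ne, span_singleton_eq_bot]; norm_num⟩

/-- **The prime `v₅ = (5)`**. [folklore] -/
def v₅ : HeightOneSpectrum (𝓞 K) := ⟨span {(5 : 𝓞 K)}, span_five.1, by
  rw [Ne, span_singleton_eq_bot]; norm_num⟩

/-- A point of the height-one spectrum containing `2` is `v₂`. [folklore] -/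
theorem eq_v₂_of_mem {v : HeightOneSpectrum (𝓞 K)} (h : (2 : 𝓞 K) ∈ v.asIdeal) : v = v₂ := by
  haveI := v.isPrime
  have := span_two.2.2 v.asIdeal (by simpa using mem_primesOver_of_mem Nat.prime_two (by simpa using h))
  exact HeightOneSpectrum.ext this

/-- A point of the height-one spectrum containing `5` is `v₅`. [folklore] -/
theorem eq_v₅_of_mem {v : HeightOneSpectrum (𝓞 K)} (h : (5 : 𝓞 K) ∈ v.asIdeal) : v = v₅ := by
  haveI := v.isPrime
  have := span_five.2.2 v.asIdeal (by simpa using mem_primesOver_of_mem Nat.prime_five (by simpa using h))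
  exact HeightOneSpectrum.ext this

/-- For a natural number `n` and a finite place `v`: `v(n) = 1 ↔ n ∉ v`. [folklore] -/
theorem valuation_natCast_eq_one_iff (v : HeightOneSpectrum (𝓞 K)) (n : ℕ) :
    v.valuation K (n : K) = 1 ↔ (n : 𝓞 K) ∉ v.asIdeal := by
  rw [show (n : K) = algebraMap (𝓞 K) K n by simp, valuation_of_algebraMap, intValuation_eq_one_iff]

/-- `v(n) ≤ 1` for a natural number `n`. [folklore] -/
theorem valuation_natCast_le_one (v : HeightOneSpectrum (𝓞 K)) (n : ℕ) : v.valuation K (n : K) ≤ 1 := by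
  rw [show (n : K) = algebraMap (𝓞 K) K n by simp]; exact valuation_le_one v _

/-! ### `σ` on `𝓞 K` and the invariance of the inert valuations; norm parity -/

/-- **`σ` restricted to `𝓞 K`**. [folklore] -/
def σint : 𝓞 K ≃+* 𝓞 K := RingOfIntegers.mapRingEquiv σ.toRingEquiv

/-- `σint` is `σ` on `K`. [folklore] -/
@[simp] theorem coe_σint (a : 𝓞 K) : ((σint a : 𝓞 K) : K) = σ (a : K) := rfl

/-- A ring automorphism of `𝓞 K` does not increase the valuation at an inert prime `(p)`. [folklore] -/
theorem intValuation_ringEquiv_le (v : HeightOneSpectrum (𝓞 K)) {p : ℕ} (hv : v.asIdeal = span {(p : 𝓞 K)})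
    (τ : 𝓞 K ≃+* 𝓞 K) (a : 𝓞 K) : v.intValuation (τ a) ≤ v.intValuation a := by
  by_cases ha : a = 0
  · simp [ha]
  have key : ∀ (b : 𝓞 K) (n : ℕ), v.intValuation b ≤ WithZero.exp (-(n : ℤ)) ↔ (p : 𝓞 K) ^ n ∣ b := by
    intro b n
    rw [intValuation_le_pow_iff_dvd, hv, Ideal.span_singleton_pow, dvd_span_singleton,
      Ideal.mem_span_singleton]
  have hva : v.intValuation a ≠ 0 := intValuation_ne_zero v a ha
  obtain ⟨m, hm⟩ : ∃ m : ℕ, v.intValuation a = WithZero.exp (-(m : ℤ)) := by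
    have hle : WithZero.log (v.intValuation a) ≤ 0 := by
      rw [← WithZero.log_one]
      exact (WithZero.log_le_log hva one_ne_zero).mpr (intValuation_le_one v a)
    refine ⟨(-WithZero.log (v.intValuation a)).toNat, ?_⟩
    rw [Int.toNat_of_nonneg (by omega), neg_neg, WithZero.exp_log hva]
  rw [hm, key]
  have h := (key a m).mp hm.le
  simpa using map_dvd τ h

/-- `v_{(p)}(τ a) = v_{(p)}(a)` for a ring automorphism `τ` of `𝓞 K` and an inert `p`. [folklore] -/
theorem intValuation_ringEquiv_eq (v : HeightOneSpectrum (𝓞 K)) {p : ℕ} (hv : v.asIdeal = span {(p : 𝓞 K)})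
    (τ : 𝓞 K ≃+* 𝓞 K) (a : 𝓞 K) : v.intValuation (τ a) = v.intValuation a := by
  refine le_antisymm (intValuation_ringEquiv_le v hv τ a) ?_
  have := intValuation_ringEquiv_le v hv τ.symm (τ a)
  rwa [τ.symm_apply_apply] at this

/-- **`σ` preserves the valuation of `K` at an inert prime `(p)`.** [folklore] -/
theorem valuation_σ_eq (v : HeightOneSpectrum (𝓞 K)) {p : ℕ} (hv : v.asIdeal = span {(p : 𝓞 K)}) (z : K) :
    v.valuation K (σ z) = v.valuation K z := by
  obtain ⟨a, b, hb, rfl⟩ := IsFractionRing.div_surjective (A := 𝓞 K) z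
  have e : σ (algebraMap (𝓞 K) K a / algebraMap (𝓞 K) K b) =
      algebraMap (𝓞 K) K (σint a) / algebraMap (𝓞 K) K (σint b) := by
    rw [map_div₀]; rfl
  rw [e, map_div₀, map_div₀, valuation_of_algebraMap, valuation_of_algebraMap, valuation_of_algebraMap,
    valuation_of_algebraMap, intValuation_ringEquiv_eq v hv, intValuation_ringEquiv_eq v hv]

/-- **Norm parity at an inert prime**: if `N_{K/ℚ}(z)` is a rational square then `ord_{(p)}(z)` is
even (`N(z) = z·σz·σ²z` has order `3 ord(z)`). [folklore] -/
theorem two_dvd_log_valuation_of_isSquare_norm (v : HeightOneSpectrum (𝓞 K)) {p : ℕ}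
    (hv : v.asIdeal = span {(p : 𝓞 K)}) {z : K} (hz : z ≠ 0) (h : IsSquare (Algebra.norm ℚ z)) :
    (2 : ℤ) ∣ WithZero.log (v.valuation K z) := by
  obtain ⟨r, hr⟩ := h
  have hN := norm_eq_mul_σ_mul_σσ z
  rw [hr, map_mul] at hN
  have hz1 : σ z ≠ 0 := (map_ne_zero σ).mpr hz
  have hz2 : σ (σ z) ≠ 0 := (map_ne_zero σ).mpr hz1
  have hr0 : (algebraMap ℚ K r) ≠ 0 := by
    intro h0
    rw [h0, zero_mul] at hN
    exact mul_ne_zero (mul_ne_zero hz hz1) hz2 hN.symm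
  have hv0 : v.valuation K z ≠ 0 := (Valuation.ne_zero_iff _).mpr hz
  have hvr : v.valuation K (algebraMap ℚ K r) ≠ 0 := (Valuation.ne_zero_iff _).mpr hr0
  have key : WithZero.log (v.valuation K (algebraMap ℚ K r * algebraMap ℚ K r)) =
      WithZero.log (v.valuation K (z * σ z * σ (σ z))) := by rw [hN]
  rw [map_mul, map_mul, map_mul, WithZero.log_mul hvr hvr,
    WithZero.log_mul (mul_ne_zero hv0 ((Valuation.ne_zero_iff _).mpr hz1)) ((Valuation.ne_zero_iff _).mpr hz2),
    WithZero.log_mul hv0 ((Valuation.ne_zero_iff _).mpr hz1), valuation_σ_eq v hv, valuation_σ_eq v hv,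
    valuation_σ_eq v hv] at key
  exact ⟨WithZero.log (v.valuation K (algebraMap ℚ K r)) - WithZero.log (v.valuation K z), by linarith⟩

/-! ### The real places: `x + 2` is totally positive -/

/-- The sign vector of an element of `K` under the three real embeddings. [folklore] -/
def sgn3 (z : K) : SignType × SignType × SignType := (SignType.sign (e₁ z), SignType.sign (e₂ z), SignType.sign (e₃ z))

/-- `sgn3` is multiplicative. [folklore] -/
theorem sgn3_mul (z w : K) : sgn3 (z * w) = sgn3 z * sgn3 w := by
  simp only [sgn3, map_mul, sign_mul, Prod.mk_mul_mk]

/-- On units, `sgn3` is the sign vector `sgn`. [folklore] -/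
theorem sgn3_coe_unit (u : (𝓞 K)ˣ) : sgn3 (((u : 𝓞 K)) : K) = sgn u := rfl

/-- A non-zero square is totally positive. [folklore] -/
theorem sgn3_sq {B : K} (hB : B ≠ 0) : sgn3 (B ^ 2) = 1 := by
  have h : ∀ e : K →+* ℝ, SignType.sign (e (B ^ 2)) = 1 := fun e => by
    rw [map_pow]
    exact sign_pos (lt_of_le_of_ne (sq_nonneg _) (Ne.symm (pow_ne_zero 2 ((map_ne_zero e).mpr hB))))
  simp only [sgn3, h]; rfl

/-- **On the real curve `Y² = X(X+2)(X-3)` with `Y ≠ 0` one has `X + 2 > 0`.** [folklore] -/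
theorem real_x_add_two_pos {X Y : ℝ} (h : Y ^ 2 = X * (X + 2) * (X - 3)) (hY : Y ≠ 0) : 0 < X + 2 := by
  by_contra hle
  rw [not_lt] at hle
  have hX : X ≤ -2 := by linarith
  have h1 : 0 < X * (X - 3) := by nlinarith
  have h3 : 0 < Y ^ 2 := lt_of_le_of_ne (sq_nonneg Y) (Ne.symm (pow_ne_zero 2 hY))
  nlinarith

/-- **`x + 2` is totally positive** for a `K`-point of `y² = x(x+2)(x-3)` with `y ≠ 0`. [folklore] -/
theorem sgn3_x_add_two {x y : K} (hE : y ^ 2 = x * (x + 2) * (x - 3)) (hy : y ≠ 0) : sgn3 (x + 2) = 1 := by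
  have h : ∀ e : K →+* ℝ, SignType.sign (e (x + 2)) = 1 := fun e => by
    rw [map_add, map_ofNat]
    refine sign_pos (real_x_add_two_pos (Y := e y) ?_ ((map_ne_zero e).mpr hy))
    have := congrArg e hE
    simpa [map_pow, map_mul, map_add, map_sub, map_ofNat] using this
  simp only [sgn3, h]; rfl

/-- **The real survivor**: the only totally positive representative `±u₁^i u₂^j` is `1`. [folklore] -/
theorem rep_eq_of_sgn_eq_one {a i j : Fin 2} (h : sgn (rep a i j) = 1) : a = 0 ∧ i = 0 ∧ j = 0 := by
  rw [sgn_rep] at h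
  revert h
  fin_cases a <;> fin_cases i <;> fin_cases j <;> decide

/-! ### At the primes above `3`: `B² - 2` has even order -/

/-- `2 ∉ 𝔮` for a prime `𝔮 ∋ 3`: `v(2) = 1`. [folklore] -/
theorem valuation_two_of_three_mem (v : HeightOneSpectrum (𝓞 K)) (h3 : (3 : 𝓞 K) ∈ v.asIdeal) :
    v.valuation K (2 : K) = 1 := by
  haveI := v.isPrime
  obtain ⟨ψ, hker⟩ := exists_residueMap_of_three_mem (P := v.asIdeal) h3
  have h := (valuation_natCast_eq_one_iff v 2).mpr
  push_cast at h
  apply h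
  rw [← hker, RingHom.mem_ker, map_ofNat]
  decide

/-- In `𝔽₃`, `a² - 2b² = 0` forces `b = 0` (`2 ≡ -1` is not a square mod `3`). [folklore] -/
theorem zmod3_sq_sub_two_mul_sq : ∀ a b : ZMod 3, b ≠ 0 → a ^ 2 - 2 * b ^ 2 ≠ 0 := by decide

/-- **`ord_𝔮(B² - 2)` is even at each prime `𝔮 ∣ 3`** (`B ∈ K`, `B ≠ 0`): if `ord(B) > 0` the order
is `ord(2) = 0`, if `ord(B) < 0` it is `2 ord(B)`, and `ord(B) = 0` with `B² - 2 ∈ 𝔮` would give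
`a² - 2b² ≡ 0` in the residue field `𝔽₃` for `B = a/b`, impossible. [folklore] -/
theorem two_dvd_log_valuation_sq_sub_two {B : K} (hB : B ≠ 0) (w : HeightOneSpectrum (𝓞 K))
    (h3 : (3 : 𝓞 K) ∈ w.asIdeal) : (2 : ℤ) ∣ WithZero.log (w.valuation K (B ^ 2 - 2)) := by
  haveI := w.isPrime
  set v := w.valuation K with hv
  have h2 : v 2 = 1 := valuation_two_of_three_mem w h3
  have hvB : v B ≠ 0 := (Valuation.ne_zero_iff v).mpr hB
  rcases lt_trichotomy (v B) 1 with hlt | heq | hgt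
  · have hB2 : v (B ^ 2) < v 2 := by
      rw [map_pow, h2, pow_two]
      calc v B * v B < 1 * 1 := mul_lt_mul'' hlt hlt zero_le zero_le
        _ = 1 := one_mul 1
    rw [sub_eq_add_neg, v.map_add_eq_of_lt_right (by rw [Valuation.map_neg]; exact hB2),
      Valuation.map_neg, h2, WithZero.log_one]
    exact dvd_zero 2
  · by_contra hodd
    have hle : v (B ^ 2 - 2) ≤ 1 := v.map_sub_le (by rw [map_pow, heq, one_pow]) h2.le
    have hne0 : B ^ 2 - 2 ≠ 0 := by
      intro h0; rw [h0, map_zero, WithZero.log_zero] at hodd; exact hodd (dvd_zero 2)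
    have hlt : v (B ^ 2 - 2) < 1 := by
      refine lt_of_le_of_ne hle fun h1 => hodd ?_
      rw [h1, WithZero.log_one]; exact dvd_zero 2
    obtain ⟨n, d, hnd⟩ := exists_primeCompl_mul_eq_of_integer w B heq.le
    obtain ⟨ψ, hker⟩ := exists_residueMap_of_three_mem (P := w.asIdeal) h3
    have hd : ψ d ≠ 0 := by
      intro h0
      have : (d : 𝓞 K) ∈ RingHom.ker ψ := h0
      rw [hker] at this
      exact d.2 this
    have hW : (B ^ 2 - 2) * (algebraMap (𝓞 K) K d) ^ 2 = algebraMap (𝓞 K) K (n ^ 2 - 2 * d ^ 2) := by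
      rw [map_sub, map_mul, map_pow, map_pow, map_ofNat, ← hnd]; ring
    have hvd : v (algebraMap (𝓞 K) K d) = 1 := by
      rw [hv, valuation_of_algebraMap, intValuation_eq_one_iff]; exact d.2
    have hWlt : v (algebraMap (𝓞 K) K (n ^ 2 - 2 * d ^ 2)) < 1 := by
      rw [← hW, map_mul, map_pow, hvd, one_pow, mul_one]; exact hlt
    rw [hv, valuation_lt_one_iff_mem] at hWlt
    have hψW : ψ (n ^ 2 - 2 * (d : 𝓞 K) ^ 2) = 0 := by
      rw [← RingHom.mem_ker, hker]; exact hWlt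
    rw [map_sub, map_mul, map_pow, map_pow, map_ofNat] at hψW
    exact zmod3_sq_sub_two_mul_sq _ _ hd hψW
  · have hB2 : v 2 < v (B ^ 2) := by
      rw [map_pow, h2, pow_two]
      calc (1 : ℤᵐ⁰) = 1 * 1 := (one_mul 1).symm
        _ < v B * v B := mul_lt_mul'' hgt hgt zero_le zero_le
    rw [sub_eq_add_neg, v.map_add_eq_of_lt_left (by rw [Valuation.map_neg]; exact hB2), map_pow,
      WithZero.log_pow]
    exact ⟨WithZero.log (v B), by ring⟩

/-! ### The `2`-adic obstruction: reduction to `𝓞/8` -/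

section TwoAdic

variable (ψ : 𝓞 K →+* O8)

/-- A ring homomorphism `𝓞 K → 𝔽₈ = O2` has kernel `(2)`. [folklore] -/
theorem ker_eq_span_two (φ : 𝓞 K →+* O2) : RingHom.ker φ = Ideal.span {(2 : 𝓞 K)} := by
  have hle : Ideal.span {(2 : 𝓞 K)} ≤ RingHom.ker φ := by
    rw [Ideal.span_singleton_le_iff_mem, RingHom.mem_ker, map_ofNat]
    decide
  haveI := span_two.1
  have hmax : (Ideal.span {(2 : 𝓞 K)}).IsMaximal :=
    Ideal.IsPrime.isMaximal inferInstance (by rw [Ne, Ideal.span_singleton_eq_bot]; norm_num)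
  haveI : Nontrivial O2 := ⟨⟨0, 1, by decide⟩⟩
  exact (hmax.eq_of_le (RingHom.ker_ne_top φ) hle).symm

/-- **Elements outside `(2)` reduce to odd triples.** [folklore] -/
theorem isOdd_of_not_mem {z : 𝓞 K} (hz : z ∉ span {(2 : 𝓞 K)}) : IsOdd (ψ z) := by
  rw [isOdd_iff_red82_ne_zero]
  intro h0
  apply hz
  have hmem : z ∈ RingHom.ker (red82.comp ψ) := by rw [RingHom.mem_ker, RingHom.comp_apply]; exact h0
  rwa [ker_eq_span_two] at hmem

/-- **Core of case `ord₂(x) = 0`**: `α u² + 2e² = w²` and `α u² - 3e² = α c²` in `𝓞 K` with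
`u, w ∉ (2)`, `ψ(e)² = 1`, `ψ α` a candidate: contradiction (`no_solution_n0`). [folklore] -/
theorem core_n0 {αO u w c e : 𝓞 K} (hcand : ψ αO ∈ candidates3)
    (hu : u ∉ span {(2 : 𝓞 K)}) (hw : w ∉ span {(2 : 𝓞 K)}) (he : ψ e * ψ e = 1)
    (h1 : αO * u ^ 2 + 2 * e ^ 2 = w ^ 2) (h2 : αO * u ^ 2 - 3 * e ^ 2 = αO * c ^ 2) : False := by
  have e1 := congrArg ψ h1
  have e2 := congrArg ψ h2
  simp only [map_add, map_sub, map_mul, map_ofNat, pow_two, he, mul_one] at e1 e2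
  exact no_solution_n0 _ hcand _ (sq_mem_usq8 _ (isOdd_of_not_mem ψ hu)) _ (sq_mem_usq8 _ (isOdd_of_not_mem ψ hw))
    (by rw [← e1]) _ (sq_mem_asq8 (ψ c)) (by rw [← e2])

/-- **Core of case `ord₂(x) = -2`**: `α u² + 8e² = w²`, `α u² - 12e² = α c²` with `u, w, c ∉ (2)`:
contradiction (`no_solution_n1`). [folklore] -/
theorem core_n1 {αO u w c e : 𝓞 K} (hcand : ψ αO ∈ candidates3)
    (hu : u ∉ span {(2 : 𝓞 K)}) (hw : w ∉ span {(2 : 𝓞 K)}) (hc : c ∉ span {(2 : 𝓞 K)}) (he : ψ e * ψ e = 1)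
    (h1 : αO * u ^ 2 + 8 * e ^ 2 = w ^ 2) (h2 : αO * u ^ 2 - 12 * e ^ 2 = αO * c ^ 2) : False := by
  have e1 := congrArg ψ h1
  have e2 := congrArg ψ h2
  simp only [map_add, map_sub, map_mul, map_ofNat, pow_two, he, mul_one] at e1 e2
  have h8 : (8 : O8) = 0 := by decide
  have h16 : (16 : O8) = 0 := by decide
  refine no_solution_n1 _ hcand _ (sq_mem_usq8 _ (isOdd_of_not_mem ψ hu)) _ (sq_mem_usq8 _ (isOdd_of_not_mem ψ hw))
    (by rw [← e1, h8]; ring) _ (sq_mem_usq8 _ (isOdd_of_not_mem ψ hc)) ?_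
  rw [← e2]
  linear_combination h16

/-- **Core of case `ord₂(x) ≤ -4`**: `α u² + 2·4^M e² = w²`, `α u² - 3·4^M e² = α c²` (`M ≥ 2`)
with `u, w, c ∉ (2)`: contradiction (`no_solution_n2`). [folklore] -/
theorem core_n2 {αO u w c e : 𝓞 K} (hcand : ψ αO ∈ candidates3)
    (hu : u ∉ span {(2 : 𝓞 K)}) (hw : w ∉ span {(2 : 𝓞 K)}) (hc : c ∉ span {(2 : 𝓞 K)}) {M : ℕ} (hM : 2 ≤ M)
    (h1 : αO * u ^ 2 + 2 * 4 ^ M * e ^ 2 = w ^ 2) (h2 : αO * u ^ 2 - 3 * 4 ^ M * e ^ 2 = αO * c ^ 2) :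
    False := by
  have e1 := congrArg ψ h1
  have e2 := congrArg ψ h2
  have h4M : (4 : O8) ^ M = 0 := by
    obtain ⟨m, rfl⟩ := Nat.exists_eq_add_of_le hM
    rw [pow_add, show (4 : O8) ^ 2 = 0 from by decide, zero_mul]
  simp only [map_add, map_sub, map_mul, map_pow, map_ofNat, pow_two, h4M, mul_zero, zero_mul, add_zero,
    sub_zero] at e1 e2
  exact no_solution_n2 _ hcand _ (sq_mem_usq8 _ (isOdd_of_not_mem ψ hu)) _ (sq_mem_usq8 _ (isOdd_of_not_mem ψ hw))
    (by rw [← e1]) _ (sq_mem_usq8 _ (isOdd_of_not_mem ψ hc)) (by rw [← e2])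

end TwoAdic

/-! ### Odd integers and `2`-adic units of `K` -/

/-- An odd rational integer is not in `(2) ⊂ 𝓞 K`. [folklore] -/
theorem intCast_not_mem_span_two (ψ : 𝓞 K →+* O8) {d : ℤ} (hd : Odd d) :
    ((d : ℤ) : 𝓞 K) ∉ span {(2 : 𝓞 K)} := by
  intro hmem
  rw [Ideal.mem_span_singleton] at hmem
  obtain ⟨e, he⟩ := hmem
  obtain ⟨k, rfl⟩ := hd
  have h := congrArg (red82.comp ψ) he
  simp only [RingHom.comp_apply, map_intCast, map_mul, map_ofNat] at h
  have h2 : (2 : O2) = 0 := by decide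
  rw [h2, zero_mul] at h
  have h1 : ((2 * k + 1 : ℤ) : O2) = 1 := by
    push_cast
    rw [h2, zero_mul, zero_add]
  rw [h1] at h
  exact absurd h (by decide)

/-- For an odd integer `d`, `ψ(d)² = 1` in `𝓞/8`. [folklore] -/
theorem ψ_intCast_sq_eq_one (ψ : 𝓞 K →+* O8) {d : ℤ} (hd : Odd d) :
    ψ (d : 𝓞 K) * ψ (d : 𝓞 K) = 1 := by
  obtain ⟨k, rfl⟩ := hd
  obtain ⟨m, hm⟩ := Int.even_mul_succ_self k
  rw [map_intCast]
  have h8 : (8 : O8) = 0 := by decide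
  have e : ((2 * k + 1 : ℤ) : O8) * ((2 * k + 1 : ℤ) : O8) = 4 * ((k * (k + 1) : ℤ) : O8) + 1 := by
    push_cast; ring
  rw [e, hm]
  push_cast
  linear_combination (m : O8) * h8

/-- `σint` preserves non-membership in `(2)`. [folklore] -/
theorem σint_not_mem_span_two {t : 𝓞 K} (ht : t ∉ span {(2 : 𝓞 K)}) : σint t ∉ span {(2 : 𝓞 K)} := by
  have hv2 : v₂.asIdeal = span {((2 : ℕ) : 𝓞 K)} := by simp [v₂]
  have h1 : v₂.intValuation (σint t) = v₂.intValuation t := intValuation_ringEquiv_eq v₂ hv2 σint t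
  intro hmem
  apply ht
  have : v₂.intValuation (σint t) < 1 := (intValuation_lt_one_iff_mem _ _).mpr hmem
  rw [h1] at this
  exact (intValuation_lt_one_iff_mem _ _).mp this

/-- The norm of `s ∈ 𝓞 K` as an element of `𝓞 K`: `N(s) = s · σs · σ²s`. [folklore] -/
theorem intCast_norm_eq (s : 𝓞 K) : ((Algebra.norm ℤ s : ℤ) : 𝓞 K) = s * σint s * σint (σint s) := by
  apply RingOfIntegers.coe_injective
  have h := norm_eq_mul_σ_mul_σσ (s : K)
  rw [← Algebra.coe_norm_int s, eq_ratCast, Rat.cast_intCast] at h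
  calc (((Algebra.norm ℤ s : ℤ) : 𝓞 K) : K) = ((Algebra.norm ℤ s : ℤ) : K) := by rfl
    _ = (s : K) * σ (s : K) * σ (σ (s : K)) := h
    _ = ((s * σint s * σint (σint s) : 𝓞 K) : K) := by push_cast; rfl

/-- **`2`-adic units of `K` have odd integral denominators**: if `v₂(z) ≤ 1` then `z · d = w` with
`w ∈ 𝓞 K`, `d ∈ ℤ` odd (`d = N(s)` for a denominator `s ∉ (2)`), and `w ∉ (2)` when `v₂(z) = 1`.
[folklore] -/
theorem exists_odd_int_mul_eq {z : K} (hz : v₂.valuation K z ≤ 1) :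
    ∃ (w : 𝓞 K) (d : ℤ), Odd d ∧ z * (d : K) = (w : K) ∧ (v₂.valuation K z = 1 → w ∉ span {(2 : 𝓞 K)}) := by
  obtain ⟨n, s, hns⟩ := exists_primeCompl_mul_eq_of_integer v₂ z hz
  have hs : (s : 𝓞 K) ∉ span {(2 : 𝓞 K)} := s.2
  haveI := span_two.1
  set d : ℤ := Algebra.norm ℤ (s : 𝓞 K) with hd
  have hdO : (d : 𝓞 K) = s * σint s * σint (σint s) := intCast_norm_eq s
  have hdnot : (d : 𝓞 K) ∉ span {(2 : 𝓞 K)} := by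
    rw [hdO]
    intro hmem
    rcases (span_two.1).mem_or_mem hmem with h12 | h3
    · rcases (span_two.1).mem_or_mem h12 with h1 | h2
      · exact hs h1
      · exact σint_not_mem_span_two hs h2
    · exact σint_not_mem_span_two (σint_not_mem_span_two hs) h3
  have hodd : Odd d := by
    rw [← Int.not_even_iff_odd]
    rintro ⟨k, hk⟩
    apply hdnot
    rw [Ideal.mem_span_singleton]
    exact ⟨k, by rw [hk]; push_cast; ring⟩
  refine ⟨n * σint s * σint (σint s), d, hodd, ?_, fun hz1 => ?_⟩
  · have e : (d : K) = (((d : 𝓞 K)) : K) := by rfl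
    rw [e, hdO]
    push_cast
    have hns' : z * ((s : 𝓞 K) : K) = (n : K) := hns
    linear_combination (((σint s : 𝓞 K)) : K) * (((σint (σint s) : 𝓞 K)) : K) * hns'
  · intro hmem
    rcases (span_two.1).mem_or_mem hmem with h12 | h3
    · rcases (span_two.1).mem_or_mem h12 with h1 | h2
      · have hvs : v₂.valuation K ((s : 𝓞 K) : K) = 1 := by
          rw [show ((s : 𝓞 K) : K) = algebraMap (𝓞 K) K s from rfl, valuation_of_algebraMap, intValuation_eq_one_iff]
          exact hs
        have hvn : v₂.valuation K ((n : 𝓞 K) : K) < 1 := by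
          rw [show ((n : 𝓞 K) : K) = algebraMap (𝓞 K) K n from rfl, valuation_lt_one_iff_mem]
          exact h1
        have : v₂.valuation K (z * ((s : 𝓞 K) : K)) = 1 := by rw [map_mul, hz1, hvs, mul_one]
        rw [show z * ((s : 𝓞 K) : K) = ((n : 𝓞 K) : K) from hns] at this
        exact absurd this hvn.ne
      · exact σint_not_mem_span_two hs h2
    · exact σint_not_mem_span_two (σint_not_mem_span_two hs) h3

/-! ### The `2`-adic obstruction for the three candidate classes -/

section Obstruction

/-- `v₂(2) = exp(-1)`. [folklore] -/
theorem valuation_v₂_two : v₂.valuation K (2 : K) = WithZero.exp (-1) := by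
  rw [← map_ofNat (algebraMap (𝓞 K) K) 2, valuation_of_algebraMap, v₂.intValuation_singleton (by norm_num) rfl]

/-- A product of three elements outside the prime `(2)` is outside `(2)`. [folklore] -/
theorem mul_mul_not_mem_span_two {a b c : 𝓞 K} (ha : a ∉ span {(2 : 𝓞 K)}) (hb : b ∉ span {(2 : 𝓞 K)})
    (hc : c ∉ span {(2 : 𝓞 K)}) : a * b * c ∉ span {(2 : 𝓞 K)} := fun h => by
  rcases (span_two.1).mem_or_mem h with hab | h3
  · rcases (span_two.1).mem_or_mem hab with h1 | h2
    · exact ha h1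
    · exact hb h2
  · exact hc h3

/-- In `ℤᵐ⁰`, `log a ≤ 0 ↔ a ≤ 1` for `a ≠ 0`. [folklore] -/
theorem log_nonpos_iff {a : ℤᵐ⁰} (ha : a ≠ 0) : WithZero.log a ≤ 0 ↔ a ≤ 1 := by
  rw [← WithZero.log_one]; exact WithZero.log_le_log ha one_ne_zero

/-- For odd integers `dA, dB, dC`, `ψ(dA dB dC)² = 1` in `𝓞/8`. [folklore] -/
theorem ψ_prod_sq_eq_one (ψ : 𝓞 K →+* O8) {dA dB dC : ℤ} (hA : Odd dA) (hB : Odd dB)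
    (hC : Odd dC) : ψ ((dA : 𝓞 K) * dB * dC) * ψ ((dA : 𝓞 K) * dB * dC) = 1 := by
  have h := ψ_intCast_sq_eq_one ψ ((hA.mul hB).mul hC)
  push_cast at h
  exact h

/-- **The `2`-adic obstruction.** Let `α ∈ 𝓞 K ∖ (2)` with `ψ₈ α` one of the three candidates, and
suppose `x = α A²`, `x + 2 = B²` (`A, B ∈ Kˣ`) for a point `(x, y)`, `y ≠ 0`, of `y² = x(x+2)(x-3)`.
This is impossible: with `x - 3 = α C²`, `C = y/(αAB)`, according to `ord₂(A) > 0`, `= 0`,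
`= -M < 0` one gets `ord₂(x + 2) = 1` odd, resp. the congruences of `core_n0`, resp. `core_n1` /
`core_n2` modulo `8`, after clearing odd integral denominators. [folklore] -/
theorem two_adic_obstruction (ψ : 𝓞 K →+* O8) {αO : 𝓞 K}
    (hα : αO ∉ span {(2 : 𝓞 K)}) (hcand : ψ αO ∈ candidates3)
    {x y A B : K} (hE : y ^ 2 = x * (x + 2) * (x - 3)) (hy : y ≠ 0) (hA : A ≠ 0) (hB : B ≠ 0)
    (hxA : x = (αO : K) * A ^ 2) (hxB : x + 2 = B ^ 2) : False := by
  set v := v₂.valuation K with hv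
  have hv2 : v 2 = WithZero.exp (-1) := valuation_v₂_two
  have hv3 : v (3 : K) ≤ 1 := by exact_mod_cast valuation_natCast_le_one v₂ 3
  have hvα : v (αO : K) = 1 := by
    rw [hv, RingOfIntegers.coe_eq_algebraMap, valuation_of_algebraMap, intValuation_eq_one_iff]; exact hα
  have hα0 : ((αO : 𝓞 K) : K) ≠ 0 := fun h0 => by rw [h0, map_zero] at hvα; exact zero_ne_one hvα
  have hx0 : x ≠ 0 := by
    intro h0
    have : x * (x + 2) * (x - 3) ≠ 0 := by rw [← hE]; exact pow_ne_zero 2 hy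
    exact this (by rw [h0]; ring)
  have hx3 : x - 3 ≠ 0 := by
    intro h0
    have : x * (x + 2) * (x - 3) ≠ 0 := by rw [← hE]; exact pow_ne_zero 2 hy
    exact this (by rw [h0]; ring)
  -- the third coordinate `x - 3 = α C²`
  set C : K := y / (((αO : 𝓞 K) : K) * A * B) with hC
  have hden : ((αO : 𝓞 K) : K) * A * B ≠ 0 := mul_ne_zero (mul_ne_zero hα0 hA) hB
  have hC0 : C ≠ 0 := div_ne_zero hy hden
  have key : y ^ 2 = (((αO : 𝓞 K) : K) * A ^ 2) * (B ^ 2) * (x - 3) := by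
    rw [← hxA, ← hxB]; exact hE
  have hxC : x - 3 = ((αO : 𝓞 K) : K) * C ^ 2 := by
    have hprod : ((αO : 𝓞 K) : K) * A ^ 2 * B ^ 2 ≠ 0 :=
      mul_ne_zero (mul_ne_zero hα0 (pow_ne_zero 2 hA)) (pow_ne_zero 2 hB)
    have hx3' : x - 3 = y ^ 2 / ((((αO : 𝓞 K) : K) * A ^ 2) * (B ^ 2)) := by
      rw [key, mul_div_cancel_left₀ _ hprod]
    rw [hx3', hC, div_pow]
    field_simp
  have hvA0 : v A ≠ 0 := (Valuation.ne_zero_iff v).mpr hA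
  have hvB0 : v B ≠ 0 := (Valuation.ne_zero_iff v).mpr hB
  have hvC0 : v C ≠ 0 := (Valuation.ne_zero_iff v).mpr hC0
  have hlx2 : WithZero.log (v (x + 2)) = 2 * WithZero.log (v B) := by
    rw [hxB, map_pow, WithZero.log_pow, nsmul_eq_mul]; push_cast; ring
  have hlx3 : WithZero.log (v (x - 3)) = 2 * WithZero.log (v C) := by
    rw [hxC, map_mul, map_pow, hvα, one_mul, WithZero.log_pow, nsmul_eq_mul]; push_cast; ring
  have hlx : WithZero.log (v x) = 2 * WithZero.log (v A) := by
    rw [hxA, map_mul, map_pow, hvα, one_mul, WithZero.log_pow, nsmul_eq_mul]; push_cast; ring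
  have hvx0 : v x ≠ 0 := (Valuation.ne_zero_iff v).mpr hx0
  have hvx30 : v (x - 3) ≠ 0 := (Valuation.ne_zero_iff v).mpr hx3
  have hxB' : ((αO : 𝓞 K) : K) * A ^ 2 + 2 = B ^ 2 := by rw [← hxA]; exact hxB
  have hxC' : ((αO : 𝓞 K) : K) * A ^ 2 - 3 = ((αO : 𝓞 K) : K) * C ^ 2 := by rw [← hxA]; exact hxC
  rcases lt_trichotomy (WithZero.log (v A)) 0 with hlt | heq | hgt
  · have hvx : v x < v 2 := by
      rw [← WithZero.exp_log hvx0, hlx, hv2, WithZero.exp_lt_exp]; omega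
    have h := congrArg WithZero.log (v.map_add_eq_of_lt_right hvx)
    rw [hlx2, hv2, WithZero.log_exp] at h
    omega
  · have hvA : v A = 1 := by rw [← WithZero.exp_log hvA0, heq, WithZero.exp_zero]
    have hvx : v x = 1 := by rw [← WithZero.exp_log hvx0, hlx, heq, mul_zero, WithZero.exp_zero]
    have hvx2 : v (x + 2) = 1 := by
      rw [v.map_add_eq_of_lt_left (by rw [hvx, hv2, ← WithZero.exp_zero, WithZero.exp_lt_exp]; norm_num)]
      exact hvx
    have hvB : v B = 1 := by
      have h := congrArg WithZero.log hvx2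
      rw [hlx2, WithZero.log_one] at h
      rw [← WithZero.exp_log hvB0, show WithZero.log (v B) = 0 by omega, WithZero.exp_zero]
    have hvx3 : v (x - 3) ≤ 1 := v.map_sub_le hvx.le hv3
    have hvC : v C ≤ 1 := by
      have h := (log_nonpos_iff hvx30).mpr hvx3
      rw [hlx3] at h
      exact (log_nonpos_iff hvC0).mp (by omega)
    obtain ⟨A₁, dA, hdA, hAd, hA₁⟩ := exists_odd_int_mul_eq hvA.le
    obtain ⟨B₁, dB, hdB, hBd, hB₁⟩ := exists_odd_int_mul_eq hvB.le
    obtain ⟨C₁, dC, hdC, hCd, -⟩ := exists_odd_int_mul_eq hvC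
    have hA₁' := hA₁ hvA
    have hB₁' := hB₁ hvB
    have hAd' : A * (dA : K) = algebraMap (𝓞 K) K A₁ := hAd
    have hBd' : B * (dB : K) = algebraMap (𝓞 K) K B₁ := hBd
    have hCd' : C * (dC : K) = algebraMap (𝓞 K) K C₁ := hCd
    have hxB'' : algebraMap (𝓞 K) K αO * A ^ 2 + 2 = B ^ 2 := hxB'
    have hxC'' : algebraMap (𝓞 K) K αO * A ^ 2 - 3 = algebraMap (𝓞 K) K αO * C ^ 2 := hxC'
    have h1O : αO * (A₁ * dB * dC) ^ 2 + 2 * ((dA : 𝓞 K) * dB * dC) ^ 2 = (B₁ * dA * dC) ^ 2 := by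
      apply RingOfIntegers.coe_injective
      simp only [map_add, map_mul, map_pow, map_ofNat, map_intCast]
      rw [← hAd', ← hBd']
      linear_combination ((dA : K) * dB * dC) ^ 2 * hxB''
    have h2O : αO * (A₁ * dB * dC) ^ 2 - 3 * ((dA : 𝓞 K) * dB * dC) ^ 2 = αO * (C₁ * dA * dB) ^ 2 := by
      apply RingOfIntegers.coe_injective
      simp only [map_sub, map_mul, map_pow, map_ofNat, map_intCast]
      rw [← hAd', ← hCd']
      linear_combination ((dA : K) * dB * dC) ^ 2 * hxC''
    exact core_n0 ψ hcand
      (mul_mul_not_mem_span_two hA₁' (intCast_not_mem_span_two ψ hdB) (intCast_not_mem_span_two ψ hdC))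
      (mul_mul_not_mem_span_two hB₁' (intCast_not_mem_span_two ψ hdA) (intCast_not_mem_span_two ψ hdC))
      (ψ_prod_sq_eq_one ψ hdA hdB hdC) h1O h2O
  · obtain ⟨M, hM⟩ : ∃ M : ℕ, WithZero.log (v A) = M :=
      ⟨(WithZero.log (v A)).toNat, (Int.toNat_of_nonneg hgt.le).symm⟩
    have hM1 : 1 ≤ M := by omega
    have hvx : v x = WithZero.exp (2 * (M : ℤ)) := by rw [← WithZero.exp_log hvx0, hlx, hM]
    have hvx2 : v (x + 2) = v x :=
      v.map_add_eq_of_lt_left (by rw [hvx, hv2, WithZero.exp_lt_exp]; omega)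
    have hvx3 : v (x - 3) = v x := by
      rw [sub_eq_add_neg]
      refine v.map_add_eq_of_lt_left ?_
      rw [Valuation.map_neg, hvx]
      calc v 3 ≤ 1 := hv3
        _ = WithZero.exp 0 := WithZero.exp_zero.symm
        _ < WithZero.exp (2 * (M : ℤ)) := WithZero.exp_lt_exp.mpr (by omega)
    have hlB : WithZero.log (v B) = M := by
      have h := congrArg WithZero.log hvx2; rw [hlx2, hvx, WithZero.log_exp] at h; omega
    have hlC : WithZero.log (v C) = M := by
      have h := congrArg WithZero.log hvx3; rw [hlx3, hvx, WithZero.log_exp] at h; omega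
    have hunit : ∀ Z : K, WithZero.log (v Z) = M → v Z ≠ 0 → v (Z * 2 ^ M) = 1 := by
      intro Z hZ hZ0
      have hne : v (Z * 2 ^ M) ≠ 0 := by
        rw [map_mul, map_pow, hv2]; exact mul_ne_zero hZ0 (pow_ne_zero _ (by simp))
      rw [← WithZero.exp_log hne, ← WithZero.exp_zero]
      congr 1
      rw [map_mul, map_pow, WithZero.log_mul hZ0 (pow_ne_zero _ (by rw [hv2]; simp)), WithZero.log_pow, hv2,
        WithZero.log_exp, hZ, nsmul_eq_mul]
      ring
    have hvA₀ := hunit A hM hvA0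
    have hvB₀ := hunit B hlB hvB0
    have hvC₀ := hunit C hlC hvC0
    obtain ⟨A₁, dA, hdA, hAd, hA₁⟩ := exists_odd_int_mul_eq hvA₀.le
    obtain ⟨B₁, dB, hdB, hBd, hB₁⟩ := exists_odd_int_mul_eq hvB₀.le
    obtain ⟨C₁, dC, hdC, hCd, hC₁⟩ := exists_odd_int_mul_eq hvC₀.le
    have hA₁' := hA₁ hvA₀
    have hB₁' := hB₁ hvB₀
    have hC₁' := hC₁ hvC₀
    have e4 : (4 : K) ^ M = (2 ^ M) ^ 2 := by
      rw [← pow_mul, mul_comm, pow_mul]; norm_num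
    have hAd' : A * 2 ^ M * (dA : K) = algebraMap (𝓞 K) K A₁ := hAd
    have hBd' : B * 2 ^ M * (dB : K) = algebraMap (𝓞 K) K B₁ := hBd
    have hCd' : C * 2 ^ M * (dC : K) = algebraMap (𝓞 K) K C₁ := hCd
    have hxB'' : algebraMap (𝓞 K) K αO * A ^ 2 + 2 = B ^ 2 := hxB'
    have hxC'' : algebraMap (𝓞 K) K αO * A ^ 2 - 3 = algebraMap (𝓞 K) K αO * C ^ 2 := hxC'
    have h1O : αO * (A₁ * dB * dC) ^ 2 + 2 * 4 ^ M * ((dA : 𝓞 K) * dB * dC) ^ 2 = (B₁ * dA * dC) ^ 2 := by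
      apply RingOfIntegers.coe_injective
      simp only [map_add, map_mul, map_pow, map_ofNat, map_intCast]
      rw [← hAd', ← hBd', e4]
      linear_combination ((dA : K) * dB * dC * 2 ^ M) ^ 2 * hxB''
    have h2O : αO * (A₁ * dB * dC) ^ 2 - 3 * 4 ^ M * ((dA : 𝓞 K) * dB * dC) ^ 2 =
        αO * (C₁ * dA * dB) ^ 2 := by
      apply RingOfIntegers.coe_injective
      simp only [map_sub, map_mul, map_pow, map_ofNat, map_intCast]
      rw [← hAd', ← hCd', e4]
      linear_combination ((dA : K) * dB * dC * 2 ^ M) ^ 2 * hxC''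
    have hu := mul_mul_not_mem_span_two hA₁' (intCast_not_mem_span_two ψ hdB) (intCast_not_mem_span_two ψ hdC)
    have hw := mul_mul_not_mem_span_two hB₁' (intCast_not_mem_span_two ψ hdA) (intCast_not_mem_span_two ψ hdC)
    have hc := mul_mul_not_mem_span_two hC₁' (intCast_not_mem_span_two ψ hdA) (intCast_not_mem_span_two ψ hdB)
    have he := ψ_prod_sq_eq_one ψ hdA hdB hdC
    rcases Nat.lt_or_ge M 2 with hM2 | hM2
    · obtain rfl : M = 1 := by omega
      rw [pow_one] at h1O h2O
      exact core_n1 ψ hcand hu hw hc he (by linear_combination h1O) (by linear_combination h2O)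
    · exact core_n2 ψ hcand hu hw hc hM2 h1O h2O

end Obstruction

/-! ### The curve `480a1 : y² = x(x + 2)(x - 3)` over `K`: `x + 2 = B²`, then `x = u A²` -/

section Curve

variable {x y : K} (hE : y ^ 2 = x * (x + 2) * (x - 3)) (hy : y ≠ 0)
include hE hy

/-- `x ≠ 0`, `x + 2 ≠ 0`, `x - 3 ≠ 0` for a point with `y ≠ 0`. [folklore] -/
theorem x_ne : x ≠ 0 ∧ x + 2 ≠ 0 ∧ x - 3 ≠ 0 := by
  have h : x * (x + 2) * (x - 3) ≠ 0 := by rw [← hE]; exact pow_ne_zero 2 hy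
  exact ⟨fun h0 => h (by rw [h0]; ring), fun h0 => h (by rw [h0]; ring), fun h0 => h (by rw [h0]; ring)⟩

/-- **`ord_v(x + 2)` is even for every finite place `v`**: at the inert `(2)`, `(5)` by
`N(x + 2) = □`, elsewhere by the parity lemma (`e = (-2, 0, 3)`). [folklore] -/
theorem two_dvd_log_valuation_x_add_two (hN : IsSquare (Algebra.norm ℚ (x + 2))) (v : HeightOneSpectrum (𝓞 K)) :
    (2 : ℤ) ∣ WithZero.log (v.valuation K (x + 2)) := by
  obtain ⟨hx0, hx2, -⟩ := x_ne hE hy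
  by_cases h2 : (2 : 𝓞 K) ∈ v.asIdeal
  · rw [eq_v₂_of_mem h2]
    exact two_dvd_log_valuation_of_isSquare_norm v₂ (p := 2) (by simp [v₂]) hx2 hN
  by_cases h5 : (5 : 𝓞 K) ∈ v.asIdeal
  · rw [eq_v₅_of_mem h5]
    exact two_dvd_log_valuation_of_isSquare_norm v₅ (p := 5) (by simp [v₅]) hx2 hN
  have hv2 : v.valuation K (2 : K) = 1 := by exact_mod_cast (valuation_natCast_eq_one_iff v 2).mpr (by exact_mod_cast h2)
  have hv5 : v.valuation K (5 : K) = 1 := by exact_mod_cast (valuation_natCast_eq_one_iff v 5).mpr (by exact_mod_cast h5)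
  have hv3 : v.valuation K (3 : K) ≤ 1 := by exact_mod_cast valuation_natCast_le_one v 3
  have key := (v.valuation K).two_dvd_log_map_sub_of_sq_eq (e₁ := -2) (e₂ := 0) (e₃ := 3) (x := x) (y := y)
    (by simp only [Valuation.map_neg, hv2, le_refl]) (by rw [map_zero]; exact zero_le_one) hv3
    (by simp only [sub_zero, Valuation.map_neg, hv2])
    (by rw [show (-2 : K) - 3 = -5 by norm_num]; simp only [Valuation.map_neg, hv5])
    (by rw [Ne, ← sub_eq_zero, sub_neg_eq_add]; exact hx2) (by rw [hE]; ring)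
  rwa [sub_neg_eq_add] at key

/-- **`x + 2 = B²`**: all valuations of `x + 2` are even and `h_K = 1`, so `x + 2 = u' B²`;
`N(x + 2) = N(u') N(B)²` is a rational square only if `N(u') = 1` (`a' = 0`), and `x + 2` is totally
positive, so `u' = 1` (`rep_eq_of_sgn_eq_one`). [folklore] -/
theorem exists_sq_eq_x_add_two (hN : IsSquare (Algebra.norm ℚ (x + 2))) : ∃ B : K, B ≠ 0 ∧ x + 2 = B ^ 2 := by
  obtain ⟨-, hx2, -⟩ := x_ne hE hy
  obtain ⟨u, w, hw⟩ := CyclicCubic13.exists_unit_mul_sq_of_even_valuation (R := 𝓞 K) (L := K) hx2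
    (two_dvd_log_valuation_x_add_two (hE := hE) (hy := hy) (hN := hN))
  obtain ⟨a, i, j, η, hu⟩ := exists_eq_rep_mul_sq u
  set B : K := (((η : (𝓞 K)ˣ) : 𝓞 K) : K) * w with hB
  have hx : x + 2 = (((rep a i j : (𝓞 K)ˣ) : 𝓞 K) : K) * B ^ 2 := by
    rw [hw, hu]
    simp only [Units.val_mul, Units.val_pow_eq_pow_val]
    push_cast
    ring
  have hB0 : B ≠ 0 := by
    intro h0; rw [h0] at hx; apply hx2; rw [hx]; ring
  have hsgn : sgn (rep a i j) = 1 := by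
    have h := sgn3_x_add_two hE hy
    rw [hx, sgn3_mul, sgn3_sq hB0, mul_one, sgn3_coe_unit] at h
    exact h
  obtain ⟨rfl, rfl, rfl⟩ := rep_eq_of_sgn_eq_one hsgn
  refine ⟨B, hB0, ?_⟩
  rw [hx]
  simp [rep]

/-- **`ord_v(x)` is even for every finite place `v`**, given `x + 2 = B²`: at `(2)` by `N(x) = □`,
at the primes above `3` because `x = B² - 2` (`two_dvd_log_valuation_sq_sub_two`), elsewhere by the
parity lemma (`e = (0, -2, 3)`). [folklore] -/
theorem two_dvd_log_valuation_x (hN : IsSquare (Algebra.norm ℚ x)) {B : K} (hB : B ≠ 0) (hxB : x + 2 = B ^ 2)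
    (v : HeightOneSpectrum (𝓞 K)) : (2 : ℤ) ∣ WithZero.log (v.valuation K x) := by
  obtain ⟨hx0, -, -⟩ := x_ne hE hy
  by_cases h2 : (2 : 𝓞 K) ∈ v.asIdeal
  · rw [eq_v₂_of_mem h2]
    exact two_dvd_log_valuation_of_isSquare_norm v₂ (p := 2) (by simp [v₂]) hx0 hN
  by_cases h3 : (3 : 𝓞 K) ∈ v.asIdeal
  · have hxe : x = B ^ 2 - 2 := by rw [← hxB]; ring
    rw [hxe]
    exact two_dvd_log_valuation_sq_sub_two hB v h3
  have hv2 : v.valuation K (2 : K) = 1 := by exact_mod_cast (valuation_natCast_eq_one_iff v 2).mpr (by exact_mod_cast h2)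
  have hv3 : v.valuation K (3 : K) = 1 := by exact_mod_cast (valuation_natCast_eq_one_iff v 3).mpr (by exact_mod_cast h3)
  have key := (v.valuation K).two_dvd_log_map_sub_of_sq_eq (e₁ := 0) (e₂ := -2) (e₃ := 3) (x := x) (y := y)
    (by rw [map_zero]; exact zero_le_one) (by simp only [Valuation.map_neg, hv2, le_refl]) (by rw [hv3])
    (by simp only [zero_sub, Valuation.map_neg, hv2]) (by simp only [zero_sub, Valuation.map_neg, hv3]) hx0
    (by rw [hE]; ring)
  rwa [sub_zero] at key

omit hE hy in
/-- The norms of the representatives: `N(±u₁^i u₂^j) = (-1)^a`. [folklore] -/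
theorem norm_rep (a i j : Fin 2) :
    Algebra.norm ℚ (((rep a i j : (𝓞 K)ˣ) : 𝓞 K) : K) = (-1) ^ (a : ℕ) := by
  have hneg : Algebra.norm ℚ (-1 : K) = -1 := by
    rw [show (-1 : K) = algebraMap ℚ K (-1) by simp, Algebra.norm_algebraMap, finrank_K]; norm_num
  have hcoe : (((rep a i j : (𝓞 K)ˣ) : 𝓞 K) : K) =
      (-1) ^ (a : ℕ) * (-2 + 3 * θ + 2 * ω) ^ (i : ℕ) * (49 + 2 * θ - 5 * ω) ^ (j : ℕ) := by
    simp only [rep, Units.val_mul, Units.val_pow_eq_pow_val, Units.val_neg, Units.val_one, coe_unit₁,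
      coe_unit₂, map_mul, map_pow, map_neg, map_one, map_add, map_sub, map_ofNat, coe_θint, coe_ωint]
  rw [hcoe, map_mul, map_mul, map_pow, map_pow, map_pow, hneg, norm_u₁, norm_u₂, one_pow, one_pow, mul_one,
    mul_one]

/-- **`x = u A²` with `u = u₁^i u₂^j`** (given `x + 2 = B²`): even valuations, `h_K = 1`, units modulo
squares, and `N(x) = □` forces `N(u) = +1`, i.e. no factor `-1`. [folklore] -/
theorem exists_rep_mul_sq_x (hN : IsSquare (Algebra.norm ℚ x)) {B : K} (hB : B ≠ 0) (hxB : x + 2 = B ^ 2) :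
    ∃ (i j : Fin 2) (A : K), A ≠ 0 ∧ x = (((rep 0 i j : (𝓞 K)ˣ) : 𝓞 K) : K) * A ^ 2 := by
  obtain ⟨hx0, -, -⟩ := x_ne hE hy
  obtain ⟨u, w, hw⟩ := CyclicCubic13.exists_unit_mul_sq_of_even_valuation (R := 𝓞 K) (L := K) hx0
    (two_dvd_log_valuation_x (hE := hE) (hy := hy) (hN := hN) hB hxB)
  obtain ⟨a, i, j, η, hu⟩ := exists_eq_rep_mul_sq u
  have hx : x = (((rep a i j : (𝓞 K)ˣ) : 𝓞 K) : K) * ((((η : (𝓞 K)ˣ) : 𝓞 K) : K) * w) ^ 2 := by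
    rw [hw, hu]
    simp only [Units.val_mul, Units.val_pow_eq_pow_val]
    push_cast
    ring
  have hA : (((η : (𝓞 K)ˣ) : 𝓞 K) : K) * w ≠ 0 := by
    intro h0; rw [h0] at hx; apply hx0; rw [hx]; ring
  have ha : a = 0 := by
    have hNx : Algebra.norm ℚ x = (-1) ^ (a : ℕ) * (Algebra.norm ℚ ((((η : (𝓞 K)ˣ) : 𝓞 K) : K) * w)) ^ 2 := by
      rw [hx, map_mul, map_pow, norm_rep]
    have hq : Algebra.norm ℚ ((((η : (𝓞 K)ˣ) : 𝓞 K) : K) * w) ≠ 0 := Algebra.norm_ne_zero_iff.mpr hA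
    by_contra ha
    obtain rfl : a = 1 := by fin_cases a; exact absurd rfl ha; rfl
    simp only [Fin.val_one, pow_one, neg_mul, one_mul] at hNx
    have hlt : Algebra.norm ℚ x < 0 := by rw [hNx]; nlinarith [sq_pos_iff.mpr hq]
    linarith [hN.nonneg]
  subst ha
  exact ⟨i, j, _, hA, hx⟩

end Curve

/-! ### Assembly: the norm-`1` descent statement for `K` -/

section Assembly

/-- A unit of `𝓞 K` is not in the prime `(2)`. [folklore] -/
theorem unit_not_mem_span_two (u : (𝓞 K)ˣ) : ((u : 𝓞 K)) ∉ span {(2 : 𝓞 K)} := fun h =>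
  (span_two.1).ne_top (Ideal.eq_top_of_isUnit_mem _ h u.isUnit)

/-- The images under `ψ₈` of the representatives `u₁^i u₂^j`. [folklore] -/
theorem ψ_rep (ψ : 𝓞 K →+* O8) (hψ : ψ θint = t8 ∧ ψ ωint = w8) (i j : Fin 2) :
    ψ ((rep 0 i j : (𝓞 K)ˣ) : 𝓞 K) = (-2 + 3 * t8 + 2 * w8) ^ (i : ℕ) * (49 + 2 * t8 - 5 * w8) ^ (j : ℕ) := by
  simp only [rep, Units.val_mul, Units.val_pow_eq_pow_val, coe_unit₁, coe_unit₂,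
    map_mul, map_pow, map_neg, map_add, map_sub, map_ofNat, hψ.1, hψ.2, Fin.val_zero, pow_zero,
    one_mul]

/-- **The three candidates are exactly the images of the non-trivial classes `u₁^i u₂^j`.**
[folklore] -/
theorem mem_candidates3 (i j : Fin 2) (hij : ¬ (i = 0 ∧ j = 0)) :
    (-2 + 3 * t8 + 2 * w8) ^ (i : ℕ) * (49 + 2 * t8 - 5 * w8) ^ (j : ℕ) ∈ candidates3 := by
  revert hij
  fin_cases i <;> fin_cases j <;> decide

/-- **The norm-`1` `2`-descent statement for `480a1` over the cyclic cubic field of conductor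
`103`.** For every `K`-point `(x, y)`, `y ≠ 0`, of `y² = x(x + 2)(x - 3)` such that `N_{K/ℚ}(x)`
and `N_{K/ℚ}(x + 2)` are rational squares, `x` and `x + 2` are squares in `K`. [folklore] -/
theorem normDescent {x y : K} (hE : y ^ 2 = x * (x + 2) * (x - 3)) (hy : y ≠ 0)
    (hNx : IsSquare (Algebra.norm ℚ x)) (hNx2 : IsSquare (Algebra.norm ℚ (x + 2))) :
    IsSquare x ∧ IsSquare (x + 2) := by
  obtain ⟨B, hB0, hxB⟩ := exists_sq_eq_x_add_two hE hy hNx2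
  obtain ⟨i, j, A, hA0, hxA⟩ := exists_rep_mul_sq_x hE hy hNx hB0 hxB
  obtain ⟨ψ, hψ⟩ := exists_ψ₈
  have hij : i = 0 ∧ j = 0 := by
    by_contra hne
    exact two_adic_obstruction ψ (αO := ((rep 0 i j : (𝓞 K)ˣ) : 𝓞 K)) (unit_not_mem_span_two _)
      (by rw [ψ_rep ψ hψ]; exact mem_candidates3 i j hne) hE hy hA0 hB0 hxA hxB
  obtain ⟨rfl, rfl⟩ := hij
  refine ⟨⟨A, ?_⟩, ⟨B, ?_⟩⟩
  · rw [hxA]; simp [rep, pow_two]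
  · rw [hxB, pow_two]

end Assembly

/-! ### Transport to any cubic field generated by a root of `f` -/

section Transport

variable {K' : Type*} [Field K'] [Algebra ℚ K']

/-- `f(z) = z³ + z² - 34z - 61` as the value of `aeval`. [folklore] -/
theorem aeval_cubicPolyRat (z : K') : aeval z cubicPolyRat = z ^ 3 + z ^ 2 - 34 * z - 61 := by
  refine (aeval_map_algebraMap ℚ z cubicPoly).trans ?_
  rw [cubicPoly, map_sub, map_sub, map_add, map_pow, map_pow, map_mul, aeval_C, aeval_X, aeval_C,
    map_ofNat, map_ofNat]

/-- **The homomorphism `K = ℚ[X]/(f) → K'`, `θ ↦ θ'`**, for a root `θ'` of `f` in `K'`. [folklore] -/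
def algHomOfRoot {θ' : K'} (h : θ' ^ 3 + θ' ^ 2 - 34 * θ' - 61 = 0) : K →ₐ[ℚ] K' :=
  AdjoinRoot.liftAlgHom cubicPolyRat (Algebra.ofId ℚ K') θ'
    (show aeval θ' cubicPolyRat = 0 by rw [aeval_cubicPolyRat, h])

/-- `algHomOfRoot h θ = θ'`. [folklore] -/
theorem algHomOfRoot_θ {θ' : K'} (h : θ' ^ 3 + θ' ^ 2 - 34 * θ' - 61 = 0) : algHomOfRoot h θ = θ' :=
  AdjoinRoot.liftAlgHom_root _ _ _ _

/-- **`K ≃ₐ[ℚ] K'` for every cubic extension `K'/ℚ` containing a root of `f`.** [folklore] -/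
def algEquivOfRoot (h3 : Module.finrank ℚ K' = 3) {θ' : K'}
    (h : θ' ^ 3 + θ' ^ 2 - 34 * θ' - 61 = 0) : K ≃ₐ[ℚ] K' :=
  haveI : FiniteDimensional ℚ K' := Module.finite_of_finrank_eq_succ h3
  AlgEquiv.ofBijective (algHomOfRoot h)
    ⟨(algHomOfRoot h).toRingHom.injective,
     (LinearMap.injective_iff_surjective_of_finrank_eq_finrank (f := (algHomOfRoot h).toLinearMap)
        (by rw [finrank_K, h3])).mp (algHomOfRoot h).toRingHom.injective⟩

/-- Squares are preserved by ring isomorphisms. [folklore] -/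
theorem isSquare_map_of_isSquare (e : K ≃ₐ[ℚ] K') {z : K} (hz : IsSquare z) : IsSquare (e z) := by
  obtain ⟨r, hr⟩ := hz
  exact ⟨e r, by rw [hr, map_mul]⟩

/-- **Transport of `normDescent` along `K ≃ₐ[ℚ] K'`.** [folklore] -/
theorem normDescent_of_algEquiv (e : K ≃ₐ[ℚ] K') {x y : K'} (hE : y ^ 2 = x * (x + 2) * (x - 3))
    (hy : y ≠ 0) (hNx : IsSquare (Algebra.norm ℚ x)) (hNx2 : IsSquare (Algebra.norm ℚ (x + 2))) :
    IsSquare x ∧ IsSquare (x + 2) := by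
  set x₀ := e.symm x with hx₀
  set y₀ := e.symm y with hy₀
  have hx : x = e x₀ := (e.apply_symm_apply x).symm
  have hyy : y = e y₀ := (e.apply_symm_apply y).symm
  have hE₀ : y₀ ^ 2 = x₀ * (x₀ + 2) * (x₀ - 3) := by
    apply e.injective
    rw [map_pow, map_mul, map_mul, map_add, map_sub, map_ofNat, map_ofNat, ← hx, ← hyy, hE]
  have hy₀' : y₀ ≠ 0 := fun h => hy (by rw [hyy, h, map_zero])
  have hN₀ : Algebra.norm ℚ x₀ = Algebra.norm ℚ x := by
    rw [hx, Algebra.norm_eq_of_algEquiv e x₀]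
  have hN₂ : Algebra.norm ℚ (x₀ + 2) = Algebra.norm ℚ (x + 2) := by
    rw [← Algebra.norm_eq_of_algEquiv e (x₀ + 2), map_add, map_ofNat, ← hx]
  obtain ⟨h1, h2⟩ := normDescent hE₀ hy₀' (hN₀ ▸ hNx) (hN₂ ▸ hNx2)
  refine ⟨hx ▸ isSquare_map_of_isSquare e h1, ?_⟩
  have : x + 2 = e (x₀ + 2) := by rw [map_add, map_ofNat, ← hx]
  rw [this]
  exact isSquare_map_of_isSquare e h2

/-- **The norm-`1` `2`-descent of `480a1` over ANY cubic extension `K'/ℚ` generated by a root of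
`f = X³ + X² - 34X - 61`** (e.g. the conductor-`103` subfield of `ℚ(ζ₁₃₃₉)`). [folklore] -/
theorem normDescent_of_root (h3 : Module.finrank ℚ K' = 3) {θ' : K'}
    (hθ' : θ' ^ 3 + θ' ^ 2 - 34 * θ' - 61 = 0) {x y : K'} (hE : y ^ 2 = x * (x + 2) * (x - 3))
    (hy : y ≠ 0) (hNx : IsSquare (Algebra.norm ℚ x)) (hNx2 : IsSquare (Algebra.norm ℚ (x + 2))) :
    IsSquare x ∧ IsSquare (x + 2) :=
  normDescent_of_algEquiv (algEquivOfRoot h3 hθ') hE hy hNx hNx2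

end Transport

end CyclicCubic103

end Literature.NumberTheory.NumberFields
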